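import Mathlib
import HarnessLib
import Literature.Computability.AlgebraicComplexity.PatternExpressions

/-!
# Route MonotoneRestoration — crux `OrbitRestorationQP` (stmt-ValiantsHypothesis-18293):
# closed labelled pattern expressions form an algebra WITHOUT spending labels

Companion of `Theorems/MonotoneRestorationOrbitRestorationQPNarrowExpressions.lean` (K1ᵉ, the expression
form of the narrow-expansion statement K1: every matrix-symmetric `VP` family is, for `n ≥ 1`, the closed
polynomial of a labelled pattern expression with `(log₂ n + c)^c` labels a side).  For K1ᵉ to be a
workable normal form, the closed polynomials of `(k, l)`-labelled expressions must be closed under the ring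
operations at FIXED `k, l`.  Sums and scalars are immediate (`close` is linear); this file records the
one non-obvious point, PRODUCTS: summing out every label of `e₁` (`sumAll`, written inline as the fold of
`sumRow`/`sumCol` over all labels) gives an expression whose value at every assignment is the constant
`e₁.close n`, so `close (mul (sumAll e₁) e₂) = close e₁ · close e₂` — no new labels, no normalising
constant, any commutative semiring.

* `value_foldr_sumRow`, `value_foldr_sumCol` — summing out a duplicate-free list of labels sums the
  value over all assignments agreeing with the given one off the list;
* `value_sumAll_eq_close` — the fully summed expression has the constant value `close`;
* **`close_mul_sumAll`** — products of closed polynomials are closed polynomials with the same labels;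
  `exists_close_eq_mul`, `exists_close_eq_add`, `exists_close_eq_smul` — the existential forms used with K1ᵉ.
-/

noncomputable section

-- `Summit.ValiantsHypothesis.ValiantsHypothesis.…` is the tree's single-conjunct layout (Sub = Summit).
set_option linter.dupNamespace false

namespace Summit.ValiantsHypothesis.ValiantsHypothesis.Theorems.OrbitRestorationQPHomPolyClose

open Literature.Computability.AlgebraicComplexity

variable {F : Type} [CommSemiring F] {k l : ℕ} (n : ℕ)

/-- **Summing out a list of row labels**: for a duplicate-free list `L` of row labels, the value of
`L.foldr sumRow e` at `(ρ, γ)` is the sum of the values of `e` at all row assignments agreeing with `ρ`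
off `L`. [folklore] -/
theorem value_foldr_sumRow (e : PatternExpr F k l) (γ : Fin l → Fin n) :
    ∀ (L : List (Fin k)), L.Nodup → ∀ ρ : Fin k → Fin n,
      (L.foldr PatternExpr.sumRow e).value n ρ γ =
        ∑ ρ' ∈ Finset.univ.filter (fun ρ' : Fin k → Fin n => ∀ a, a ∉ L → ρ' a = ρ a),
          e.value n ρ' γ
  | [], _, ρ => by
    have : Finset.univ.filter (fun ρ' : Fin k → Fin n => ∀ a, a ∉ ([] : List (Fin k)) → ρ' a = ρ a)
        = {ρ} := by
      ext ρ'
      simp only [Finset.mem_filter, Finset.mem_univ, true_and, List.not_mem_nil, not_false_eq_true,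
        forall_const, Finset.mem_singleton]
      exact ⟨fun h => funext h, fun h a => by rw [h]⟩
    rw [List.foldr_nil, this, Finset.sum_singleton]
  | a :: L, hL, ρ => by
    classical
    have haL : a ∉ L := (List.nodup_cons.1 hL).1
    rw [List.foldr_cons, PatternExpr.value_sumRow]
    simp_rw [value_foldr_sumRow e γ L (List.nodup_cons.1 hL).2]
    rw [← Finset.sum_fiberwise (Finset.univ.filter
      (fun ρ' : Fin k → Fin n => ∀ b, b ∉ a :: L → ρ' b = ρ b)) (fun ρ' => ρ' a)]
    refine Finset.sum_congr rfl fun v _ => Finset.sum_congr ?_ fun _ _ => rfl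
    ext ρ'
    simp only [Finset.mem_filter, Finset.mem_univ, true_and, List.mem_cons, not_or]
    constructor
    · intro h
      refine ⟨fun b hb => ?_, by simpa using h a haL⟩
      rw [h b hb.2, Function.update_of_ne hb.1]
    · rintro ⟨h, hv⟩ b hb
      by_cases hba : b = a
      · subst hba; simpa using hv
      · rw [Function.update_of_ne hba]
        exact h b ⟨hba, hb⟩

/-- **Summing out a list of column labels** (the column twin of `value_foldr_sumRow`). [folklore] -/
theorem value_foldr_sumCol (e : PatternExpr F k l) (ρ : Fin k → Fin n) :
    ∀ (L : List (Fin l)), L.Nodup → ∀ γ : Fin l → Fin n,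
      (L.foldr PatternExpr.sumCol e).value n ρ γ =
        ∑ γ' ∈ Finset.univ.filter (fun γ' : Fin l → Fin n => ∀ b, b ∉ L → γ' b = γ b),
          e.value n ρ γ'
  | [], _, γ => by
    have : Finset.univ.filter (fun γ' : Fin l → Fin n => ∀ b, b ∉ ([] : List (Fin l)) → γ' b = γ b)
        = {γ} := by
      ext γ'
      simp only [Finset.mem_filter, Finset.mem_univ, true_and, List.not_mem_nil, not_false_eq_true,
        forall_const, Finset.mem_singleton]
      exact ⟨fun h => funext h, fun h b => by rw [h]⟩
    rw [List.foldr_nil, this, Finset.sum_singleton]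
  | b :: L, hL, γ => by
    classical
    have hbL : b ∉ L := (List.nodup_cons.1 hL).1
    rw [List.foldr_cons, PatternExpr.value_sumCol]
    simp_rw [value_foldr_sumCol e ρ L (List.nodup_cons.1 hL).2]
    rw [← Finset.sum_fiberwise (Finset.univ.filter
      (fun γ' : Fin l → Fin n => ∀ d, d ∉ b :: L → γ' d = γ d)) (fun γ' => γ' b)]
    refine Finset.sum_congr rfl fun v _ => Finset.sum_congr ?_ fun _ _ => rfl
    ext γ'
    simp only [Finset.mem_filter, Finset.mem_univ, true_and, List.mem_cons, not_or]
    constructor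
    · intro h
      refine ⟨fun d hd => ?_, by simpa using h b hbL⟩
      rw [h d hd.2, Function.update_of_ne hd.1]
    · rintro ⟨h, hv⟩ d hd
      by_cases hdb : d = b
      · subst hdb; simpa using hv
      · rw [Function.update_of_ne hdb]
        exact h d ⟨hdb, hd⟩

/-- **The fully summed-out expression has the constant value `close`**: summing out all `l` column
labels and then all `k` row labels of `e` gives, at every assignment, `e.close n`. [folklore] -/
theorem value_sumAll_eq_close (e : PatternExpr F k l) (ρ : Fin k → Fin n) (γ : Fin l → Fin n) :
    ((List.finRange k).foldr PatternExpr.sumRow ((List.finRange l).foldr PatternExpr.sumCol e)).value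
        n ρ γ = e.close n := by
  rw [value_foldr_sumRow n _ γ (List.finRange k) (List.nodup_finRange k) ρ, PatternExpr.close]
  have hk : Finset.univ.filter (fun ρ' : Fin k → Fin n => ∀ a, a ∉ List.finRange k → ρ' a = ρ a)
      = Finset.univ :=
    Finset.filter_true_of_mem fun ρ' _ a ha => absurd (List.mem_finRange a) ha
  rw [hk]
  refine Finset.sum_congr rfl fun ρ' _ => ?_
  rw [value_foldr_sumCol n e ρ' (List.finRange l) (List.nodup_finRange l) γ]
  have hl : Finset.univ.filter (fun γ' : Fin l → Fin n => ∀ b, b ∉ List.finRange l → γ' b = γ b)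
      = Finset.univ :=
    Finset.filter_true_of_mem fun γ' _ b hb => absurd (List.mem_finRange b) hb
  rw [hl]

/-- **Products cost no labels**: `close (mul (sumAll e₁) e₂) = close e₁ · close e₂` for expressions
with the same numbers of labels, over any commutative semiring. [folklore] -/
theorem close_mul_sumAll (e₁ e₂ : PatternExpr F k l) :
    (PatternExpr.mul ((List.finRange k).foldr PatternExpr.sumRow
        ((List.finRange l).foldr PatternExpr.sumCol e₁)) e₂).close n = e₁.close n * e₂.close n := by
  simp only [PatternExpr.close, PatternExpr.value_mul, value_sumAll_eq_close, ← Finset.mul_sum]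

/-- Closed `(k,l)`-expressions are closed under products (existential form). [folklore] -/
theorem exists_close_eq_mul (e₁ e₂ : PatternExpr F k l) :
    ∃ e : PatternExpr F k l, e.close n = e₁.close n * e₂.close n :=
  ⟨_, close_mul_sumAll n e₁ e₂⟩

/-- Closed `(k,l)`-expressions are closed under sums (existential form). [folklore] -/
theorem exists_close_eq_add (e₁ e₂ : PatternExpr F k l) :
    ∃ e : PatternExpr F k l, e.close n = e₁.close n + e₂.close n :=
  ⟨PatternExpr.add e₁ e₂, by
    simp only [PatternExpr.close, PatternExpr.value_add, Finset.sum_add_distrib]⟩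

/-- Closed `(k,l)`-expressions are closed under scalars (existential form). [folklore] -/
theorem exists_close_eq_smul (a : F) (e₁ : PatternExpr F k l) :
    ∃ e : PatternExpr F k l, e.close n = a • e₁.close n :=
  ⟨PatternExpr.mul (PatternExpr.const a) e₁, by
    simp only [PatternExpr.close, PatternExpr.value_mul, PatternExpr.value_const, Finset.smul_sum,
      MvPolynomial.smul_eq_C_mul]⟩

end Summit.ValiantsHypothesis.ValiantsHypothesis.Theorems.OrbitRestorationQPHomPolyClose

end
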